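import Literature.Computability.Cryptography.ChenQuantumLWEJointNonDemolition

/-!
# Displayed members of the jointly non-demolition class, including entangling ones (supplement to the joint multi-run T4)

REPRODUCTION / ANALYSIS OF A CLAIMED RESULT UNDER ADJUDICATION (withdrawn): Yilei Chen, *Quantum
Algorithms for Lattice Problems*, IACR ePrint 2024/555, version of 2024-04-18 [ChenQuantumLattice2024]
(the version carrying the author's note that Step 9 contains a bug), Step 9 (§3.5.9, pp. 34–38) acting
on the line kets `|φ_{b,v′}⟩` of repeated runs (one linear equation (41), p. 38, per run; Claim 3.14,
pp. 33–34).  Bundle `papers/QuantumAdvantage/lwe-quantum-autopsy/`, Part 2 (`REPAIR-CENSUS.md` §1 **T4**,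
§14.1 (β), §15; `REFEREE.md` N-24.1), supplement of `ChenQuantumLWEJointNonDemolition.lean`.
HONEST FRAMING: kernel-checked THEOREMS about states occurring in a WITHDRAWN algorithm — they make
the NON-VACUITY of the joint no-go visible, NOT summit progress, no cryptanalytic claim in either
direction, no new algorithm; quantum lower bounds are out of scope.

## What is proved

`IsJointND.exists_eq_smul` (previous module) is a statement about every operator on the joint
register of `r` runs that is non-demolition on every consistent joint instance; its hypothesis
`IsJointND` assumes nothing about the structure of the operator.  The referee (N-24.1) asked for
DISPLAYED members of that class that genuinely act on several registers.  This module records the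
closure properties and the members:

* `IsND.add`, `IsND.comp`, `IsND.smul_op`, `isND_id`, `isND_zero`, and their joint forms
  `IsJointND.add`, `IsJointND.comp`, `IsJointND.smul`, `isJointND_id`, `isJointND_zero`: the jointly
  non-demolition operators form a unital subalgebra.
* `liftSnd e E₂` (`1 ⊗ E₂` on a split register), `liftSnd_tmul`, `IsND.liftSnd`,
  **`IsJointND.isJointND_liftSnd`**: an operator jointly non-demolition on the registers of runs
  `1,…,r` (offsets `Fin.tail v′`), applied to those registers of the joint state of `r+1` runs, is
  jointly non-demolition.
* **`isJointND_liftFst_add_liftSnd`**, **`isJointND_liftFst_comp_liftSnd`**: for a single-run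
  coset-non-demolition `E₁` (at `v′₀`) and a jointly non-demolition `E′` on the remaining runs, the
  operators `E₁ ⊗ 1 + 1 ⊗ E′` and `(E₁ ⊗ 1)(1 ⊗ E′) = E₁ ⊗ E′` are jointly non-demolition on all `r+1`
  runs — by induction every sum of products of per-run coset-non-demolition operations (e.g. the joint
  observable `Π^{(1)} ⊗ 1 + 1 ⊗ Π^{(2)}` of two runs' public stabiliser projectors, which is not a
  product operator) is a member, and `IsJointND.exists_eq_smul` says each acts on the joint knowable
  family as one scalar.

References: [ChenQuantumLattice2024] Y. Chen, *Quantum Algorithms for Lattice Problems*, IACR ePrint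
2024/555 (2024), withdrawn 2024-04-18, §3.5.9 pp. 34–38, Claim 3.14 pp. 33–34, eq. (41) p. 38.
-/

namespace Literature.Computability.Cryptography.Chen2024

open scoped BigOperators

/-! ### Closure properties of `IsND` -/

section Generic

variable {V : Type*} [AddCommMonoid V] [Module ℂ V]

/-- Sums of non-demolition operators are non-demolition (on the same vector). [folklore] -/
theorem IsND.add {A B : V →ₗ[ℂ] V} {x : V} (hA : IsND A x) (hB : IsND B x) : IsND (A + B) x := by
  obtain ⟨a, ha⟩ := hA
  obtain ⟨b, hb⟩ := hB
  exact ⟨a + b, by rw [LinearMap.add_apply, ha, hb, add_smul]⟩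

/-- Composites of non-demolition operators are non-demolition. [folklore] -/
theorem IsND.comp {A B : V →ₗ[ℂ] V} {x : V} (hA : IsND A x) (hB : IsND B x) : IsND (A ∘ₗ B) x := by
  obtain ⟨a, ha⟩ := hA
  obtain ⟨b, hb⟩ := hB
  exact ⟨b * a, by rw [LinearMap.comp_apply, hb, map_smul, ha, smul_smul]⟩

/-- Scalar multiples of a non-demolition operator are non-demolition. [folklore] -/
theorem IsND.smul_op {A : V →ₗ[ℂ] V} {x : V} (hA : IsND A x) (t : ℂ) : IsND (t • A) x := by
  obtain ⟨a, ha⟩ := hA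
  exact ⟨t * a, by rw [LinearMap.smul_apply, ha, smul_smul]⟩

/-- The identity is non-demolition. [folklore] -/
theorem isND_id (x : V) : IsND (LinearMap.id : V →ₗ[ℂ] V) x :=
  ⟨1, by rw [LinearMap.id_apply, one_smul]⟩

/-- The zero operator is (vacuously) non-demolition: it is the dead branch. [folklore] -/
theorem isND_zero (x : V) : IsND (0 : V →ₗ[ℂ] V) x :=
  ⟨0, by rw [LinearMap.zero_apply, zero_smul]⟩

end Generic

/-! ### `1 ⊗ E₂` -/

section Product

variable {X X₁ X₂ : Type*} (e : X ≃ X₁ × X₂)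

/-- A SECOND-FACTOR OPERATION on the split register (`1 ⊗ E₂`). [folklore] -/
noncomputable def liftSnd (E₂ : (X₂ → ℂ) →ₗ[ℂ] (X₂ → ℂ)) : (X → ℂ) →ₗ[ℂ] (X → ℂ) where
  toFun Ψ := fun x => E₂ (fun x₂ => Ψ (e.symm ((e x).1, x₂))) (e x).2
  map_add' Ψ Ψ' := by
    funext x
    have : (fun x₂ => (Ψ + Ψ') (e.symm ((e x).1, x₂)))
        = (fun x₂ => Ψ (e.symm ((e x).1, x₂))) + fun x₂ => Ψ' (e.symm ((e x).1, x₂)) := rfl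
    rw [this, map_add]
    rfl
  map_smul' a Ψ := by
    funext x
    have : (fun x₂ => (a • Ψ) (e.symm ((e x).1, x₂)))
        = a • fun x₂ => Ψ (e.symm ((e x).1, x₂)) := rfl
    rw [this, map_smul]
    rfl

/-- `(1 ⊗ E₂)(f ⊗ g) = f ⊗ (E₂ g)`. [folklore] -/
theorem liftSnd_tmul (E₂ : (X₂ → ℂ) →ₗ[ℂ] (X₂ → ℂ)) (f : X₁ → ℂ) (g : X₂ → ℂ) :
    liftSnd e E₂ (tmul e f g) = tmul e f (E₂ g) := by
  funext x
  show E₂ (fun x₂ => tmul e f g (e.symm ((e x).1, x₂))) (e x).2 = _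
  have : (fun x₂ => tmul e f g (e.symm ((e x).1, x₂))) = f (e x).1 • g := by
    funext x₂; rw [tmul_apply_symm, Pi.smul_apply, smul_eq_mul]
  rw [this, map_smul, Pi.smul_apply, smul_eq_mul, tmul_apply]

/-- A second-factor operation non-demolition on `g` is non-demolition on every `f ⊗ g`. [folklore] -/
theorem IsND.liftSnd {E₂ : (X₂ → ℂ) →ₗ[ℂ] (X₂ → ℂ)} {g : X₂ → ℂ} (h : IsND E₂ g)
    (f : X₁ → ℂ) : IsND (liftSnd e E₂) (tmul e f g) := by
  obtain ⟨c, hc⟩ := h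
  exact ⟨c, by rw [liftSnd_tmul, hc, tmul_smul_right]⟩

end Product

/-! ### Members of `IsJointND` -/

section MultiRun

variable {n : ℕ} {D p₁ Q : ℕ+}
variable {r : ℕ} {U : Finset (Fin (n + 1))} {bk : Fin (n + 1) → ℤ}

/-- Jointly non-demolition operators are closed under sums. [folklore] -/
theorem IsJointND.add {v' : Fin r → Fin (n + 1) → ℤ}
    {A B : ((Fin r → (Fin (n + 1) → ZN D p₁ Q)) → ℂ) →ₗ[ℂ] ((Fin r → (Fin (n + 1) → ZN D p₁ Q)) → ℂ)}
    (hA : IsJointND n D p₁ Q r U bk v' A) (hB : IsJointND n D p₁ Q r U bk v' B) :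
    IsJointND n D p₁ Q r U bk v' (A + B) :=
  fun b hb w hw => (hA b hb w hw).add (hB b hb w hw)

/-- … under composition. [folklore] -/
theorem IsJointND.comp {v' : Fin r → Fin (n + 1) → ℤ}
    {A B : ((Fin r → (Fin (n + 1) → ZN D p₁ Q)) → ℂ) →ₗ[ℂ] ((Fin r → (Fin (n + 1) → ZN D p₁ Q)) → ℂ)}
    (hA : IsJointND n D p₁ Q r U bk v' A) (hB : IsJointND n D p₁ Q r U bk v' B) :
    IsJointND n D p₁ Q r U bk v' (A ∘ₗ B) :=
  fun b hb w hw => (hA b hb w hw).comp (hB b hb w hw)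

/-- … under scalars. [folklore] -/
theorem IsJointND.smul {v' : Fin r → Fin (n + 1) → ℤ}
    {A : ((Fin r → (Fin (n + 1) → ZN D p₁ Q)) → ℂ) →ₗ[ℂ] ((Fin r → (Fin (n + 1) → ZN D p₁ Q)) → ℂ)}
    (hA : IsJointND n D p₁ Q r U bk v' A) (t : ℂ) : IsJointND n D p₁ Q r U bk v' (t • A) :=
  fun b hb w hw => (hA b hb w hw).smul_op t

/-- The identity is jointly non-demolition. [folklore] -/
theorem isJointND_id (v' : Fin r → Fin (n + 1) → ℤ) :
    IsJointND n D p₁ Q r U bk v' LinearMap.id :=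
  fun _ _ _ _ => isND_id _

/-- The zero operator is jointly non-demolition (a dead branch). [folklore] -/
theorem isJointND_zero (v' : Fin r → Fin (n + 1) → ℤ) :
    IsJointND n D p₁ Q r U bk v' 0 :=
  fun _ _ _ _ => isND_zero _

/-- The joint state of `r+1` runs splits as (run 0) ⊗ (runs 1..r). [folklore] -/
theorem jointPhiKet_succ (b : Fin (n + 1) → ℤ) (w : Fin (r + 1) → Fin (n + 1) → ℤ) :
    jointPhiKet n D p₁ Q (r + 1) b w
      = tmul (splitEquiv r (Fin (n + 1) → ZN D p₁ Q)) (phi8bKet n D p₁ Q b (w 0))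
          (jointPhiKet n D p₁ Q r b (Fin.tail w)) := by
  unfold jointPhiKet
  rw [jointKet_succ]
  rfl

/-- **An operation on the registers of runs `1,…,r`** that is jointly non-demolition there (true
offsets `Fin.tail v′`), applied to those registers of the joint state of all `r+1` runs, is jointly
non-demolition. [cite: ChenQuantumLattice2024, §3.5.9 pp. 34–38, eq. (41) p. 38] -/
theorem IsJointND.isJointND_liftSnd {v' : Fin (r + 1) → Fin (n + 1) → ℤ}
    {E' : ((Fin r → (Fin (n + 1) → ZN D p₁ Q)) → ℂ) →ₗ[ℂ] ((Fin r → (Fin (n + 1) → ZN D p₁ Q)) → ℂ)}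
    (hE' : IsJointND n D p₁ Q r U bk (Fin.tail v') E') :
    IsJointND n D p₁ Q (r + 1) U bk v' (liftSnd (splitEquiv r (Fin (n + 1) → ZN D p₁ Q)) E') := by
  intro b hb w hw
  rw [jointPhiKet_succ]
  exact IsND.liftSnd _ (hE' b hb (Fin.tail w) fun i => hw i.succ) _

/-- **DISPLAYED ENTANGLING MEMBERS, I: `E₁ ⊗ 1 + 1 ⊗ E′`.**  For a single-run coset-non-demolition
`E₁` at run 0's offset and a jointly non-demolition `E′` on runs `1,…,r`, the sum `E₁ ⊗ 1 + 1 ⊗ E′`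
— in general NOT a product operator (e.g. two runs' public stabiliser projectors `Π ⊗ 1 + 1 ⊗ Π`) —
is jointly non-demolition on all `r+1` runs; by `IsJointND.exists_eq_smul` it acts on the joint
knowable family as one scalar. [cite: ChenQuantumLattice2024, §3.5.9 pp. 34–38, Claim 3.14 pp. 33–34, eq. (41) p. 38] -/
theorem isJointND_liftFst_add_liftSnd {v' : Fin (r + 1) → Fin (n + 1) → ℤ}
    {E₁ : Ket (n + 1) ((D * D * (p₁ * Q) : ℕ+) : ℕ) →ₗ[ℂ] Ket (n + 1) ((D * D * (p₁ * Q) : ℕ+) : ℕ)}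
    (hE₁ : IsCosetND n D p₁ Q U bk (v' 0) E₁)
    {E' : ((Fin r → (Fin (n + 1) → ZN D p₁ Q)) → ℂ) →ₗ[ℂ] ((Fin r → (Fin (n + 1) → ZN D p₁ Q)) → ℂ)}
    (hE' : IsJointND n D p₁ Q r U bk (Fin.tail v') E') :
    IsJointND n D p₁ Q (r + 1) U bk v'
      (liftFst (splitEquiv r (Fin (n + 1) → ZN D p₁ Q)) E₁
        + liftSnd (splitEquiv r (Fin (n + 1) → ZN D p₁ Q)) E') :=
  (hE₁.isJointND_liftFst).add hE'.isJointND_liftSnd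

/-- **DISPLAYED ENTANGLING MEMBERS, II: `E₁ ⊗ E′ = (E₁ ⊗ 1)(1 ⊗ E′)`** — products of per-run safe
operations, hence (with I and `IsJointND.smul`) every polynomial in them. [cite: ChenQuantumLattice2024, §3.5.9 pp. 34–38, eq. (41) p. 38] -/
theorem isJointND_liftFst_comp_liftSnd {v' : Fin (r + 1) → Fin (n + 1) → ℤ}
    {E₁ : Ket (n + 1) ((D * D * (p₁ * Q) : ℕ+) : ℕ) →ₗ[ℂ] Ket (n + 1) ((D * D * (p₁ * Q) : ℕ+) : ℕ)}
    (hE₁ : IsCosetND n D p₁ Q U bk (v' 0) E₁)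
    {E' : ((Fin r → (Fin (n + 1) → ZN D p₁ Q)) → ℂ) →ₗ[ℂ] ((Fin r → (Fin (n + 1) → ZN D p₁ Q)) → ℂ)}
    (hE' : IsJointND n D p₁ Q r U bk (Fin.tail v') E') :
    IsJointND n D p₁ Q (r + 1) U bk v'
      (liftFst (splitEquiv r (Fin (n + 1) → ZN D p₁ Q)) E₁
        ∘ₗ liftSnd (splitEquiv r (Fin (n + 1) → ZN D p₁ Q)) E') :=
  (hE₁.isJointND_liftFst).comp hE'.isJointND_liftSnd

/-- **Two runs, concretely**: for coset-non-demolition `E₁` (at `v′₀`) and `E₂` (at `v′₁`) the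
operator `E₁ ⊗ 1 + 1 ⊗ E₂` on the two registers is jointly non-demolition, hence ONE scalar on the
joint knowable family `{|φ_{b,w₀}⟩ ⊗ |φ_{b,w₁}⟩}` (odd `P`, odd `Q`, `gcd(p₁,Q) = 1`, `0 ∉ U ≠ ∅`,
`bk₀ = −1`). [cite: ChenQuantumLattice2024, §3.5.9 pp. 34–38, Claim 3.14 pp. 33–34, eq. (41) p. 38] -/
theorem twoRun_sum_exists_eq_smul {v' : Fin 2 → Fin (n + 1) → ℤ}
    {E₁ E₂ : Ket (n + 1) ((D * D * (p₁ * Q) : ℕ+) : ℕ) →ₗ[ℂ] Ket (n + 1) ((D * D * (p₁ * Q) : ℕ+) : ℕ)}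
    (hE₁ : IsCosetND n D p₁ Q U bk (v' 0) E₁) (hE₂ : IsCosetND n D p₁ Q U bk (v' 1) E₂)
    (hP : Odd ((p₁ * Q : ℕ+) : ℕ)) (hQ : Odd ((Q : ℕ+) : ℕ)) (hpQ : Nat.Coprime (p₁ : ℕ) (Q : ℕ))
    (hU : (0 : Fin (n + 1)) ∉ U) (hU' : U.Nonempty) (hbk0 : bk 0 = -1) :
    ∃ c : ℂ, ∀ b, InClass n p₁ U bk b → ∀ w : Fin 2 → Fin (n + 1) → ℤ,
      (∀ i, SameCoset n D p₁ Q U bk (v' i) (w i)) →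
        (liftFst (splitEquiv 1 (Fin (n + 1) → ZN D p₁ Q)) E₁
            + liftSnd (splitEquiv 1 (Fin (n + 1) → ZN D p₁ Q))
                (liftFst (splitEquiv 0 (Fin (n + 1) → ZN D p₁ Q)) E₂))
          (jointPhiKet n D p₁ Q 2 b w) = c • jointPhiKet n D p₁ Q 2 b w := by
  have h2 : IsJointND n D p₁ Q 1 U bk (Fin.tail v')
      (liftFst (splitEquiv 0 (Fin (n + 1) → ZN D p₁ Q)) E₂) :=
    IsCosetND.isJointND_liftFst (r := 0) hE₂
  exact (isJointND_liftFst_add_liftSnd hE₁ h2).exists_eq_smul hP hQ hpQ hU hU' hbk0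

end MultiRun

end Literature.Computability.Cryptography.Chen2024
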